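import Literature.AlgebraicGeometry.Resolution.ArithmeticalThreefoldsLocalRankReductionEmbedded
import Literature.AlgebraicGeometry.Resolution.ExcellentRingsFieldProofs
import HarnessLib

/-!
# Resolution of affine integral surfaces over an excellent regular base, from CJS Thm. 1.4 (`B = ∅`) alone

Topic: `Literature/AlgebraicGeometry/Resolution` (proofs only: no new notions, no new named facts).

A corollary of `CossartJannsenSaito2020Embedded.hasResolution_Spec_of_surjective`
(`ArithmeticalThreefoldsLocalRankReductionEmbedded.lean`): the spectrum of a domain `D` of finite type over a
regular excellent domain `S` (e.g. a field) with `dim D ≤ 2` admits a resolution of singularities, GRANTED ONLY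
Cossart–Jannsen–Saito's EMBEDDED theorem (Thm. 1.4 with `B = ∅`, the named fact `CossartJannsenSaito2020Embedded`).
The embedding used is `Spec D ↪ Spec S[x₁,…,xₙ][Y][X]` (a presentation with two spare variables), whose kernel
contains the height-two prime `(X, Y)`, so that the codimension hypothesis of the embedded-to-resolution theorem holds.

* `CossartJannsenSaito2020Embedded.hasResolution_Spec_of_finiteType` — over a regular excellent domain `S`;
* `CossartJannsenSaito2020Embedded.hasResolution_Spec_of_finiteType_field` — over a field.

This is the AFFINE part of "resolution of surfaces over fields (`CossartJannsenSaito2020`) from the embedded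
theorem"; the projective part (needed by `ResolutionOverUpToDim.of_projective`) requires a codimension-two
re-embedding of `ℙⁿ_k` and is not done here.

## Sources

* V. Cossart, U. Jannsen, S. Saito, LNM 2270 (2020), Thm. 1.2, Thm. 1.4. [CossartJannsenSaito2020]
-/

noncomputable section

open CategoryTheory AlgebraicGeometry IsLocalRing Polynomial

namespace Literature.AlgebraicGeometry.Resolution

universe u

/-- Engine (private, abstract ring): a surjection `ψ : A ↠ D` from a regular excellent domain onto a domain of
dimension `≤ 2` whose kernel contains primes `0 < 𝔭₁ < 𝔭₂` gives a resolution of `Spec D`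
(`CossartJannsenSaito2020Embedded.hasResolution_Spec_of_surjective`, the kernel having height `≥ 2`).
[cite: CossartJannsenSaito2020, Thm. 1.4] -/
private theorem hasResolution_Spec_of_surjective_of_chain
    (hCJSE : CossartJannsenSaito2020Embedded.{u}) {A D : Type u} [CommRing A] [IsDomain A]
    [IsRegularRing A] (hA : IsExcellentRing A) [CommRing D] [IsDomain D] (ψ : A →+* D)
    (hψ : Function.Surjective ψ)
    (hdim : ringKrullDim D ≤ 2) {𝔭₁ 𝔭₂ : Ideal A} [𝔭₁.IsPrime] [𝔭₂.IsPrime]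
    (h01 : ⊥ < 𝔭₁) (h12 : 𝔭₁ < 𝔭₂) (h2k : 𝔭₂ ≤ RingHom.ker ψ) :
    Scheme.HasResolution (Spec (.of D)) := by
  have hh2 : (2 : ℕ∞) ≤ (RingHom.ker ψ).height := by
    have a1 := Ideal.height_strict_mono_of_isPrime h01
    have a2 := Ideal.height_strict_mono_of_isPrime h12
    rw [Ideal.height_bot] at a1
    have b1 : (1 : ℕ∞) ≤ 𝔭₁.height := Order.one_le_iff_ne_zero.mpr a1.ne'
    have b2 : 𝔭₁.height + 1 ≤ 𝔭₂.height := Order.add_one_le_of_lt a2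
    have b3 : (1 : ℕ∞) + 1 ≤ 𝔭₂.height := le_trans (by gcongr) b2
    exact b3.trans (Ideal.height_mono h2k)
  exact hCJSE.hasResolution_Spec_of_surjective hA ψ hψ hdim hh2

/-- **Affine integral schemes of dimension `≤ 2` of finite type over a regular excellent domain are resolvable,
from CJS Thm. 1.4 (`B = ∅`)**: if `D` is a domain of finite type over a regular excellent domain `S` with
`dim D ≤ 2`, then `Spec D` admits a resolution of singularities.  Present `D = S[x₁,…,xₙ]/I` and map
`B = S[x][Y][X] ↠ D` through the constant coefficients; `B` is a regular excellent Noetherian ring and the kernel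
contains the primes `(X) ⊂ (X, Y)`, hence has height `≥ 2`; apply
`CossartJannsenSaito2020Embedded.hasResolution_Spec_of_surjective`.
[cite: CossartJannsenSaito2020, Thm. 1.4 (with Thm. 1.2 as the statement being recovered)] -/
theorem CossartJannsenSaito2020Embedded.hasResolution_Spec_of_finiteType
    (hCJSE : CossartJannsenSaito2020Embedded.{u}) {S D : Type u} [CommRing S] [IsDomain S]
    [IsRegularRing S] (hS : IsExcellentRing S) [CommRing D] [IsDomain D] [Algebra S D]
    [Algebra.FiniteType S D] (hdim : ringKrullDim D ≤ 2) :
    Scheme.HasResolution (Spec (.of D)) := by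
  classical
  obtain ⟨n, f, hf⟩ := Algebra.FiniteType.iff_quotient_mvPolynomial''.mp ‹Algebra.FiniteType S D›
  let cc : (MvPolynomial (Fin n) S)[X][X] →+* (MvPolynomial (Fin n) S)[X] := Polynomial.constantCoeff
  let cc' : (MvPolynomial (Fin n) S)[X] →+* MvPolynomial (Fin n) S := Polynomial.constantCoeff
  let ψ : (MvPolynomial (Fin n) S)[X][X] →+* D := f.toRingHom.comp (cc'.comp cc)
  -- `ψ` is surjective
  have hψ : Function.Surjective ψ := by
    intro d
    obtain ⟨a, rfl⟩ := hf d
    refine ⟨C (C a), ?_⟩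
    change f (cc' (cc (C (C a)))) = f a
    simp [cc, cc']
  -- the primes `⊥ < (X) < (X, Y) ≤ ker ψ`
  haveI h𝔭₁ : (RingHom.ker cc).IsPrime := RingHom.ker_isPrime _
  haveI h𝔭₂ : (RingHom.ker (cc'.comp cc)).IsPrime := RingHom.ker_isPrime _
  have h12 : RingHom.ker cc < RingHom.ker (cc'.comp cc) := by
    refine lt_of_le_of_ne (fun x hx => ?_) (fun h => ?_)
    · change (cc'.comp cc) x = 0
      rw [RingHom.comp_apply, show cc x = 0 from hx, map_zero]
    · have hY : (C X : (MvPolynomial (Fin n) S)[X][X]) ∈ RingHom.ker (cc'.comp cc) := by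
        change cc' (cc (C X)) = 0
        simp [cc, cc']
      rw [← h] at hY
      have : cc (C X) = 0 := hY
      simp [cc] at this
  have h01 : (⊥ : Ideal ((MvPolynomial (Fin n) S)[X][X])) < RingHom.ker cc := by
    refine bot_lt_iff_ne_bot.mpr fun h => ?_
    have hX : (X : (MvPolynomial (Fin n) S)[X][X]) ∈ RingHom.ker cc := by
      change cc X = 0
      simp [cc]
    rw [h] at hX
    exact Polynomial.X_ne_zero ((Submodule.mem_bot _).mp hX)
  have h2k : RingHom.ker (cc'.comp cc) ≤ RingHom.ker ψ := by
    intro x hx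
    change f ((cc'.comp cc) x) = 0
    rw [show (cc'.comp cc) x = 0 from hx, map_zero]
  -- `B` is excellent (regularity and Noetherianity are instances)
  have hB : IsExcellentRing ((MvPolynomial (Fin n) S)[X][X]) := hS.of_finiteType'
  exact hasResolution_Spec_of_surjective_of_chain hCJSE (A := (MvPolynomial (Fin n) S)[X][X]) hB ψ hψ
    hdim h01 h12 h2k

/-- **Affine integral surfaces over a field are resolvable from CJS Thm. 1.4 (`B = ∅`)**: the spectrum of a domain of
finite type over a field `k`, of dimension `≤ 2`, admits a resolution of singularities — the affine part of CJS
Thm. 1.2 over fields (`CossartJannsenSaito2020`), recovered from the embedded theorem alone (fields are excellent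
regular domains). [cite: CossartJannsenSaito2020, Thm. 1.2 and Thm. 1.4] -/
theorem CossartJannsenSaito2020Embedded.hasResolution_Spec_of_finiteType_field
    (hCJSE : CossartJannsenSaito2020Embedded.{u}) {k D : Type u} [Field k] [CommRing D] [IsDomain D]
    [Algebra k D] [Algebra.FiniteType k D] (hdim : ringKrullDim D ≤ 2) :
    Scheme.HasResolution (Spec (.of D)) :=
  hCJSE.hasResolution_Spec_of_finiteType (isExcellentRing_of_field k) hdim

end Literature.AlgebraicGeometry.Resolution

end
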